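import Literature.Geometry.Kaehler.ComplexTorusAnalyticTranslatesConservationOfNumber
import HarnessLib

/-!
# Point counts detect multiplicity one: `sign(e)^k · [Y] ∧ [D₀] ∧ ⋯ ∧ [D_{k−1}] = [Z(τ)]` iff `#Z(τ) = N`,
# and in expected dimension zero the multiplicity-one locus is open, dense and of full measure on EVERY
# compact complex torus

Layer `Literature/Geometry/Kaehler`; lane `lit-hodgefound`, seat p07, programme «INTERSECTION NUMBERS ARE
POINT COUNTS», file 14. Let `X = E/Λ` be a compact complex torus of dimension `g`, `Y ⊆ X` closed analytic
of pure dimension `k`, `D₀, …, D_{k−1}` closed analytic hypersurfaces, `Z(τ) = Y ∩ ⋂_j (D_j − τ_j)` (expected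
dimension `0`), `c = sign(e)^k · [Y]_e ∧ [D₀]_e ∧ ⋯ ∧ [D_{k−1}]_e` and `N = ∫_X sign(e) · c ∈ ℕ` the intersection
number (file 11). For every `τ` with `Z(τ)` FINITE, file 8 writes `c = [Z(τ)]_e + cl(T_τ)` with `T_τ ≥ 0` a
`0`-cycle on `Z(τ)`, and `N = #Z(τ) + deg T_τ` (file 11). Hence

  `c = [Z(τ)]_e` (every point of `Z(τ)` has multiplicity one)  `iff`  `#Z(τ) = N`,

Fulton's "`(𝒳 · 𝒱)_t` is an effective cycle of degree `N` whose support is `X_t ∩ V_t`" read backwards: the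
count is `N` exactly when all the multiplicities are `1` ([Fulton1998, §10.2 Example 10.2.1 (b), §8.2 (8.8)
`∫ V · W = Σ_P i(P; V · W)` and Prop. 8.2 (`i = 1` iff transversal)]). Consequently the multiplicity-one
locus in expected dimension `0` coincides with the locus `#Z(τ) = N` of file 11, which is OPEN, DENSE and
of FULL MEASURE with no positivity hypothesis on `X` (file 13 needs (P) / a polarisation for density in
positive dimension).

Contents (theorems only; no definitions, no named facts; `e : Fin (2g) ≃ ι` any real basis):

* §1 `torusIntegral_smul_eq_ncard_of_smul_wedge_wedgeFamily_eq_setCycleClass` (`c = [Z(τ)] ⟹ N = #Z(τ)`),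
  `smul_wedge_wedgeFamily_eq_setCycleClass_of_torusIntegral_smul_eq_ncard` (`N = #Z(τ) ⟹ c = [Z(τ)]`), and
  **`smul_wedge_wedgeFamily_eq_setCycleClass_iff_torusIntegral_smul_eq_ncard`**;
* §2 `setOf_finite_and_smul_wedge_wedgeFamily_eq_setCycleClass_eq` (the two loci coincide) and
  **`exists_nat_isOpen_dense_ae_finite_and_smul_wedge_wedgeFamily_eq_setCycleClass`** — in expected
  dimension `0` the multiplicity-one locus `{τ | Z(τ) finite, c = [Z(τ)]}` is open, dense and co-null on
  every compact complex torus.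

## References

* [Fulton1998] W. Fulton, *Intersection Theory*, 2nd ed., Springer 1998, §8.2 ((8.8), Prop. 8.2),
  §10.2 Example 10.2.1, Example 11.4.5.
* [Lange2023AbelianVarietiesComplex] H. Lange, *Abelian Varieties over the Complex Numbers*, Springer 2023,
  §4.6.2 Lemma 4.6.4 and p. 235.
* [Chirka1989] E. M. Chirka, *Complex Analytic Sets*, Kluwer 1989, §10.2 (p. 105), §12.3.
* [GriffithsHarris1978] P. Griffiths, J. Harris, *Principles of Algebraic Geometry*, Ch. 0 §4.
-/

noncomputable section

open scoped Manifold Topology Pointwise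
open MeasureTheory Set Function Filter Module
open Literature.LinearAlgebra.Alternating

namespace Literature.Geometry.Kaehler
namespace ComplexTorus

universe u

variable {ι : Type*} [Fintype ι] [DecidableEq ι] {E : Type u} [NormedAddCommGroup E] [InnerProductSpace ℂ E]
  [FiniteDimensional ℂ E] [MeasurableSpace E] [BorelSpace E] (Φ : (ι → ℝ) ≃L[ℝ] E) {g : ℕ} (e : Fin (2 * g) ≃ ι)

/-! ### §0 Finite members -/

omit [DecidableEq ι] [FiniteDimensional ℂ E] [MeasurableSpace E] [BorelSpace E] in
/-- A finite intersection of closed analytic subsets of the torus is analytic. [cite: Chirka1989, §2.1 item 3] -/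
private theorem isAnalyticSet_iInter_fin₁₄ {k : ℕ} {A : Fin k → Set (ComplexTorus Φ)}
    (hA : ∀ j, IsAnalyticSet 𝓘(ℂ, E) (A j)) : IsAnalyticSet 𝓘(ℂ, E) (⋂ j, A j) := by
  classical
  have h : ∀ s : Finset (Fin k), IsAnalyticSet 𝓘(ℂ, E) (⋂ j ∈ s, A j) := by
    intro s
    induction s using Finset.induction_on with
    | empty => simpa using (isAnalyticSet_univ : IsAnalyticSet 𝓘(ℂ, E) (univ : Set (ComplexTorus Φ)))
    | insert j s hj ih =>
      rw [Finset.set_biInter_insert]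
      exact (hA j).inter ih
  simpa using h Finset.univ

omit [DecidableEq ι] [MeasurableSpace E] [BorelSpace E] in
/-- `Z(τ)` finite and non-empty has pure dimension `0`. [cite: Chirka1989, §2.3, p. 23; §12.1, p. 136] -/
private theorem hasPureDim_zero_inter_iInter_translate_of_finite₁₄ {k d q : ℕ}
    {Y : Set (ComplexTorus Φ)} {D : Fin k → Set (ComplexTorus Φ)} (hY : HasPureDim 𝓘(ℂ, E) Y d)
    (hD : ∀ j, HasPureDim 𝓘(ℂ, E) (D j) q) (τ : Fin k → ComplexTorus Φ)
    (hfin : (Y ∩ ⋂ j, (fun x ↦ x + τ j) ⁻¹' D j).Finite) (hne : (Y ∩ ⋂ j, (fun x ↦ x + τ j) ⁻¹' D j).Nonempty) :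
    HasPureDim 𝓘(ℂ, E) (Y ∩ ⋂ j, (fun x ↦ x + τ j) ⁻¹' D j) 0 := by
  have hZan : IsAnalyticSet 𝓘(ℂ, E) (Y ∩ ⋂ j, (fun x ↦ x + τ j) ⁻¹' D j) :=
    hY.isAnalyticSet.inter
      (isAnalyticSet_iInter_fin₁₄ Φ fun j ↦ (hasPureDim_preimage_add_right Φ (hD j) (τ j)).isAnalyticSet)
  refine hasPureDim_zero_of_forall_isolated hZan hne fun a ha ↦ ?_
  refine ⟨((Y ∩ ⋂ j, (fun x ↦ x + τ j) ⁻¹' D j) \ {a})ᶜ,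
    (hfin.subset fun x hx ↦ hx.1).isClosed.isOpen_compl.mem_nhds (by simp), fun x hx ↦ ?_⟩
  by_contra hxa
  exact hx.1 ⟨hx.2, hxa⟩

/-- The set-level class of the empty set vanishes. [folklore] -/
private theorem setCycleClass_of_eq_empty₁₄ {d k' : ℕ} (h : 2 * d + k' = 2 * g) {Z : Set (ComplexTorus Φ)}
    (h0 : Z = ∅) : setCycleClass Φ e h Z = 0 := by
  have hne : ¬ HasPureDim 𝓘(ℂ, E) Z d := fun h' ↦ by
    have := h'.nonempty
    rw [h0] at this
    exact Set.not_nonempty_empty this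
  rw [setCycleClass, dif_neg hne]

/-- `∫_X [Z]_e = sign(e) · #Z` for a finite analytic `Z` (`[Z]_e = #Z · [pt]_e`, `[pt]_e = sign(e) · vol_e`).
[cite: VoisinHodgeI2002, §12.1.3] [cite: Lange2023AbelianVarietiesComplex, §6.2.4 p. 310] -/
private theorem torusIntegral_setCycleClass_of_hasPureDim_zero₁₄ (h2 : 2 * 0 + 2 * g = 2 * g)
    {Z : Set (ComplexTorus Φ)} (hZ : HasPureDim 𝓘(ℂ, E) Z 0) :
    torusIntegral Φ e (setCycleClass Φ e h2 Z) = (Z.ncard : ℂ) * orientationSign Φ e := by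
  have hvol : volumeForm Φ ((finCongr (by omega : 2 * g = 2 * g)).trans e) = volumeForm Φ e := by
    rw [finCongr_refl, Equiv.refl_trans]
  rw [setCycleClass_of_hasPureDim Φ e h2 hZ, analyticCycleClass_eq_ncard_smul_of_hasPureDim_zero Φ e h2 hZ,
    analyticCycleClass_singleton_eq_smul_volumeForm Φ e h2, hvol, torusIntegral_smul, torusIntegral_smul,
    torusIntegral_volumeForm, mul_one]

/-- `∫_X cl(T) = sign(e) · deg T` for an analytic `0`-cycle `T`. [cite: VoisinHodgeI2002, §12.1.3] -/
private theorem torusIntegral_chainCycleClass_zero₁₄ (h2 : 2 * 0 + 2 * g = 2 * g)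
    (T : HolomorphicChain 𝓘(ℂ, E) (ComplexTorus Φ) 0) :
    torusIntegral Φ e (chainCycleClass Φ e h2 T) =
      ((∑ W ∈ T.finite_components_of_compactSpace.toFinset, T.mult W : ℤ) : ℂ) * orientationSign Φ e := by
  have hvol : volumeForm Φ ((finCongr (by omega : 2 * g = 2 * g)).trans e) = volumeForm Φ e := by
    rw [finCongr_refl, Equiv.refl_trans]
  rw [chainCycleClass_eq_degree_smul_volumeForm Φ e h2 T, hvol, torusIntegral_smul, torusIntegral_volumeForm, mul_one]

/-! ### §1 `c = [Z(τ)]` iff `#Z(τ) = N` -/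

/-- **Multiplicity one forces `N = #Z(τ)`**: if `Z(τ) = Y ∩ ⋂_j (D_j − τ_j)` is finite and
`sign(e)^k · [Y]_e ∧ [D₀]_e ∧ ⋯ ∧ [D_{k−1}]_e = [Z(τ)]_e`, then `N = ∫_X sign(e)^{k+1} · [Y]_e ∧ ⋯ = #Z(τ)`
(`∫_X [Z]_e = sign(e) · #Z`). [cite: Fulton1998, §8.2 (8.8) and §10.2 Example 10.2.1 (b)]
[cite: Lange2023AbelianVarietiesComplex, §4.6.2 p. 235] -/
theorem torusIntegral_smul_eq_ncard_of_smul_wedge_wedgeFamily_eq_setCycleClass {q : ℕ}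
    (hq : 2 * q + 2 * 1 = 2 * g) (k : ℕ) {p : ℕ} (hk : 2 * k + 2 * p = 2 * g) {Y : Set (ComplexTorus Φ)}
    (hY : HasPureDim 𝓘(ℂ, E) Y k) {D : Fin k → Set (ComplexTorus Φ)} (hD : ∀ j, HasPureDim 𝓘(ℂ, E) (D j) q)
    (τ : Fin k → ComplexTorus Φ) (hfin : (Y ∩ ⋂ j, (fun x ↦ x + τ j) ⁻¹' D j).Finite)
    (hcl : (orientationSign Φ e : ℂ) ^ k •
        ((analyticCycleClass Φ e hk hY).wedge
            (wedgeFamily k fun j ↦ analyticCycleClass Φ e hq (hD j))).domDomCongr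
          (finCongr (by omega : 2 * p + 2 * k = 2 * g)) =
      setCycleClass Φ e (by omega : 2 * 0 + 2 * g = 2 * g) (Y ∩ ⋂ j, (fun x ↦ x + τ j) ⁻¹' D j)) :
    torusIntegral Φ e ((orientationSign Φ e : ℂ) ^ (k + 1) •
        ((analyticCycleClass Φ e hk hY).wedge
            (wedgeFamily k fun j ↦ analyticCycleClass Φ e hq (hD j))).domDomCongr
          (finCongr (by omega : 2 * p + 2 * k = 2 * g))) =
      ((Y ∩ ⋂ j, (fun x ↦ x + τ j) ⁻¹' D j).ncard : ℂ) := by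
  have hsq : (orientationSign Φ e : ℂ) * orientationSign Φ e = 1 := by exact_mod_cast orientationSign_mul_self Φ e
  have h2 : 2 * 0 + 2 * g = 2 * g := by omega
  rw [pow_succ', mul_smul, hcl, torusIntegral_smul]
  rcases (Y ∩ ⋂ j, (fun x ↦ x + τ j) ⁻¹' D j).eq_empty_or_nonempty with h0 | hne
  · rw [setCycleClass_of_eq_empty₁₄ Φ e h2 h0, torusIntegral_zero, mul_zero, h0, ncard_empty, Nat.cast_zero]
  · rw [torusIntegral_setCycleClass_of_hasPureDim_zero₁₄ Φ e h2
      (hasPureDim_zero_inter_iInter_translate_of_finite₁₄ Φ hY hD τ hfin hne)]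
    linear_combination ((Y ∩ ⋂ j, (fun x ↦ x + τ j) ⁻¹' D j).ncard : ℂ) * hsq

/-- **`N = #Z(τ)` forces multiplicity one**: if `Z(τ)` is finite and `∫_X sign(e)^{k+1} · [Y]_e ∧ [D₀]_e ∧ ⋯ = #Z(τ)`,
then `sign(e)^k · [Y]_e ∧ [D₀]_e ∧ ⋯ ∧ [D_{k−1}]_e = [Z(τ)]_e`: the effective excess `0`-cycle `T_τ` of file 8 has
degree `N − #Z(τ) = 0`, so `T_τ = 0`. [cite: Fulton1998, §8.2 (8.8), Prop. 8.2 and §10.2 Example 10.2.1 (b)]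
[cite: Lange2023AbelianVarietiesComplex, §4.6.2 p. 235] -/
theorem smul_wedge_wedgeFamily_eq_setCycleClass_of_torusIntegral_smul_eq_ncard {q : ℕ}
    (hq : 2 * q + 2 * 1 = 2 * g) (k : ℕ) {p : ℕ} (hk : 2 * k + 2 * p = 2 * g) {Y : Set (ComplexTorus Φ)}
    (hY : HasPureDim 𝓘(ℂ, E) Y k) {D : Fin k → Set (ComplexTorus Φ)} (hD : ∀ j, HasPureDim 𝓘(ℂ, E) (D j) q)
    (τ : Fin k → ComplexTorus Φ) (hfin : (Y ∩ ⋂ j, (fun x ↦ x + τ j) ⁻¹' D j).Finite)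
    (hN : torusIntegral Φ e ((orientationSign Φ e : ℂ) ^ (k + 1) •
        ((analyticCycleClass Φ e hk hY).wedge
            (wedgeFamily k fun j ↦ analyticCycleClass Φ e hq (hD j))).domDomCongr
          (finCongr (by omega : 2 * p + 2 * k = 2 * g))) =
      ((Y ∩ ⋂ j, (fun x ↦ x + τ j) ⁻¹' D j).ncard : ℂ)) :
    (orientationSign Φ e : ℂ) ^ k •
        ((analyticCycleClass Φ e hk hY).wedge
            (wedgeFamily k fun j ↦ analyticCycleClass Φ e hq (hD j))).domDomCongr
          (finCongr (by omega : 2 * p + 2 * k = 2 * g)) =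
      setCycleClass Φ e (by omega : 2 * 0 + 2 * g = 2 * g) (Y ∩ ⋂ j, (fun x ↦ x + τ j) ⁻¹' D j) := by
  classical
  have hsq : (orientationSign Φ e : ℂ) * orientationSign Φ e = 1 := by exact_mod_cast orientationSign_mul_self Φ e
  have h2 : 2 * 0 + 2 * g = 2 * g := by omega
  rcases (Y ∩ ⋂ j, (fun x ↦ x + τ j) ⁻¹' D j).eq_empty_or_nonempty with h0 | hne
  · -- empty: both sides vanish
    have hcl := wedge_wedgeFamily_eq_zero_of_inter_iInter_translate_eq_empty Φ e hq k hk le_rfl hY hD τ h0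
    change _ = setCycleClass Φ e h2 (Y ∩ ⋂ j, (fun x ↦ x + τ j) ⁻¹' D j)
    rw [hcl, domDomCongr_finCongr_zero, smul_zero, setCycleClass_of_eq_empty₁₄ Φ e h2 h0]
  · have hZ0 := hasPureDim_zero_inter_iInter_translate_of_finite₁₄ Φ hY hD τ hfin hne
    obtain ⟨T, hT0, -, hTcl⟩ :=
      exists_effectiveCycle_smul_wedge_wedgeFamily_eq_setCycleClass_add_of_hasPureDim_zero Φ e hq k hk
        (p' := g) (by omega) hY hD τ hZ0
    -- `N = #Z + deg T`, so `deg T = 0`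
    set M : ℤ := ∑ W ∈ T.finite_components_of_compactSpace.toFinset, T.mult W with hM
    have hTint : torusIntegral Φ e (chainCycleClass Φ e h2 T) = (M : ℂ) * orientationSign Φ e := by
      rw [torusIntegral_chainCycleClass_zero₁₄ Φ e h2 T]
    have hcomp : torusIntegral Φ e ((orientationSign Φ e : ℂ) ^ (k + 1) •
        ((analyticCycleClass Φ e hk hY).wedge
            (wedgeFamily k fun j ↦ analyticCycleClass Φ e hq (hD j))).domDomCongr
          (finCongr (by omega : 2 * p + 2 * k = 2 * g))) =
        ((Y ∩ ⋂ j, (fun x ↦ x + τ j) ⁻¹' D j).ncard : ℂ) + (M : ℂ) := by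
      rw [pow_succ', mul_smul, hTcl, torusIntegral_smul, torusIntegral_add,
        torusIntegral_setCycleClass_of_hasPureDim_zero₁₄ Φ e h2 hZ0, hTint]
      linear_combination (((Y ∩ ⋂ j, (fun x ↦ x + τ j) ⁻¹' D j).ncard : ℂ) + (M : ℂ)) * hsq
    have hM0 : M = 0 := by
      rw [hcomp] at hN
      have h : (M : ℂ) = 0 := by linear_combination hN
      exact_mod_cast h
    -- all multiplicities vanish: `T = 0`
    have hsum0 : ∑ W ∈ T.finite_components_of_compactSpace.toFinset, T.mult W = 0 := by
      rw [← hM]; exact hM0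
    have hmult : ∀ W ∈ T.finite_components_of_compactSpace.toFinset, T.mult W = 0 :=
      (Finset.sum_eq_zero_iff_of_nonneg fun W _ ↦ hT0 W).1 hsum0
    have hT : T = 0 := by
      rw [HolomorphicChain.eq_zero_iff_toFinset_eq_empty, Finset.eq_empty_iff_forall_notMem]
      intro W hW
      exact (T.finite_components_of_compactSpace.mem_toFinset.1 hW) (hmult W hW)
    change _ = setCycleClass Φ e h2 (Y ∩ ⋂ j, (fun x ↦ x + τ j) ⁻¹' D j)
    have hTcl' : (orientationSign Φ e : ℂ) ^ k •
        ((analyticCycleClass Φ e hk hY).wedge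
            (wedgeFamily k fun j ↦ analyticCycleClass Φ e hq (hD j))).domDomCongr
          (finCongr (by omega : 2 * p + 2 * k = 2 * g)) =
        setCycleClass Φ e h2 (Y ∩ ⋂ j, (fun x ↦ x + τ j) ⁻¹' D j) + chainCycleClass Φ e h2 T := hTcl
    rw [hTcl', hT, chainCycleClass_zero, add_zero]

/-- **POINT COUNTS DETECT MULTIPLICITY ONE.** For `Z(τ) = Y ∩ ⋂_j (D_j − τ_j)` finite (`dim Y = k`, `k`
hypersurfaces, any real basis `e`):

  `sign(e)^k · [Y]_e ∧ [D₀]_e ∧ ⋯ ∧ [D_{k−1}]_e = [Z(τ)]_e  ↔  ∫_X sign(e)^{k+1} · [Y]_e ∧ [D₀]_e ∧ ⋯ = #Z(τ)`,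

i.e. every point of `Z(τ)` is counted with multiplicity one iff the number of points is the intersection
number `N` ("`∫ V · W = Σ_P i(P; V·W)`" with all `i(P) ≥ 1`). [cite: Fulton1998, §8.2 (8.8), Prop. 8.2 and §10.2 Example 10.2.1 (b)]
[cite: Lange2023AbelianVarietiesComplex, §4.6.2 Lemma 4.6.4 and p. 235] [cite: GriffithsHarris1978, Ch. 0 §4] -/
theorem smul_wedge_wedgeFamily_eq_setCycleClass_iff_torusIntegral_smul_eq_ncard {q : ℕ}
    (hq : 2 * q + 2 * 1 = 2 * g) (k : ℕ) {p : ℕ} (hk : 2 * k + 2 * p = 2 * g) {Y : Set (ComplexTorus Φ)}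
    (hY : HasPureDim 𝓘(ℂ, E) Y k) {D : Fin k → Set (ComplexTorus Φ)} (hD : ∀ j, HasPureDim 𝓘(ℂ, E) (D j) q)
    (τ : Fin k → ComplexTorus Φ) (hfin : (Y ∩ ⋂ j, (fun x ↦ x + τ j) ⁻¹' D j).Finite) :
    (orientationSign Φ e : ℂ) ^ k •
        ((analyticCycleClass Φ e hk hY).wedge
            (wedgeFamily k fun j ↦ analyticCycleClass Φ e hq (hD j))).domDomCongr
          (finCongr (by omega : 2 * p + 2 * k = 2 * g)) =
      setCycleClass Φ e (by omega : 2 * 0 + 2 * g = 2 * g) (Y ∩ ⋂ j, (fun x ↦ x + τ j) ⁻¹' D j) ↔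
    torusIntegral Φ e ((orientationSign Φ e : ℂ) ^ (k + 1) •
        ((analyticCycleClass Φ e hk hY).wedge
            (wedgeFamily k fun j ↦ analyticCycleClass Φ e hq (hD j))).domDomCongr
          (finCongr (by omega : 2 * p + 2 * k = 2 * g))) =
      ((Y ∩ ⋂ j, (fun x ↦ x + τ j) ⁻¹' D j).ncard : ℂ) :=
  ⟨torusIntegral_smul_eq_ncard_of_smul_wedge_wedgeFamily_eq_setCycleClass Φ e hq k hk hY hD τ hfin,
    smul_wedge_wedgeFamily_eq_setCycleClass_of_torusIntegral_smul_eq_ncard Φ e hq k hk hY hD τ hfin⟩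

/-! ### §2 In expected dimension zero the multiplicity-one locus is the locus `#Z(τ) = N`: open, dense, co-null -/

/-- **The multiplicity-one locus is the locus `#Z(τ) = N`** (`N ∈ ℕ` the intersection number,
`∫_X sign(e)^{k+1} · [Y]_e ∧ ⋯ = N`): `{τ | Z(τ) finite, c = [Z(τ)]} = {τ | Z(τ) finite, #Z(τ) = N}`.
[cite: Fulton1998, §8.2 (8.8) and §10.2 Example 10.2.1 (b)] [cite: Lange2023AbelianVarietiesComplex, §4.6.2 p. 235] -/
theorem setOf_finite_and_smul_wedge_wedgeFamily_eq_setCycleClass_eq {q : ℕ}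
    (hq : 2 * q + 2 * 1 = 2 * g) (k : ℕ) {p : ℕ} (hk : 2 * k + 2 * p = 2 * g) {Y : Set (ComplexTorus Φ)}
    (hY : HasPureDim 𝓘(ℂ, E) Y k) {D : Fin k → Set (ComplexTorus Φ)} (hD : ∀ j, HasPureDim 𝓘(ℂ, E) (D j) q)
    {N : ℕ} (hN : torusIntegral Φ e ((orientationSign Φ e : ℂ) ^ (k + 1) •
        ((analyticCycleClass Φ e hk hY).wedge
            (wedgeFamily k fun j ↦ analyticCycleClass Φ e hq (hD j))).domDomCongr
          (finCongr (by omega : 2 * p + 2 * k = 2 * g))) = N) :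
    {τ : Fin k → ComplexTorus Φ | (Y ∩ ⋂ j, (fun x ↦ x + τ j) ⁻¹' D j).Finite ∧
      (orientationSign Φ e : ℂ) ^ k •
          ((analyticCycleClass Φ e hk hY).wedge
              (wedgeFamily k fun j ↦ analyticCycleClass Φ e hq (hD j))).domDomCongr
            (finCongr (by omega : 2 * p + 2 * k = 2 * g)) =
        setCycleClass Φ e (by omega : 2 * 0 + 2 * g = 2 * g) (Y ∩ ⋂ j, (fun x ↦ x + τ j) ⁻¹' D j)} =
    {τ : Fin k → ComplexTorus Φ | (Y ∩ ⋂ j, (fun x ↦ x + τ j) ⁻¹' D j).Finite ∧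
      (Y ∩ ⋂ j, (fun x ↦ x + τ j) ⁻¹' D j).ncard = N} := by
  ext τ
  simp only [mem_setOf_eq]
  refine ⟨fun ⟨hfin, hcl⟩ ↦ ⟨hfin, ?_⟩, fun ⟨hfin, hn⟩ ↦ ⟨hfin, ?_⟩⟩
  · have h := torusIntegral_smul_eq_ncard_of_smul_wedge_wedgeFamily_eq_setCycleClass Φ e hq k hk hY hD τ hfin hcl
    rw [hN] at h
    exact_mod_cast h.symm
  · refine smul_wedge_wedgeFamily_eq_setCycleClass_of_torusIntegral_smul_eq_ncard Φ e hq k hk hY hD τ hfin ?_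
    rw [hN, hn]

/-- **IN EXPECTED DIMENSION ZERO THE MULTIPLICITY-ONE LOCUS IS OPEN, DENSE AND OF FULL MEASURE — ON EVERY
COMPACT COMPLEX TORUS.** Let `Y ⊆ X` be closed analytic of pure dimension `k` and `D₀, …, D_{k−1}` closed
analytic hypersurfaces. Then `N = ∫_X sign(e)^{k+1} · [Y]_e ∧ [D₀]_e ∧ ⋯ ∈ ℕ` and the set of `τ ∈ X^k` for which
`Z(τ) = Y ∩ ⋂_j (D_j − τ_j)` is finite with `sign(e)^k · [Y]_e ∧ ⋯ ∧ [D_{k−1}]_e = [Z(τ)]_e` (all the finitely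
many intersection points of multiplicity one) is open, dense and contains almost every `τ` (file 11's
locus `#Z(τ) = N`, §2). No positivity hypothesis on `X` is needed in dimension `0` (contrast file 13).
[cite: Fulton1998, §10.2 Example 10.2.1 and Example 11.4.5] [cite: Lange2023AbelianVarietiesComplex, §4.6.2 Lemma 4.6.4 and p. 235]
[cite: Chirka1989, §10.2, p. 105] -/
theorem exists_nat_isOpen_dense_ae_finite_and_smul_wedge_wedgeFamily_eq_setCycleClass {q : ℕ}
    (hq : 2 * q + 2 * 1 = 2 * g) (k : ℕ) {p : ℕ} (hk : 2 * k + 2 * p = 2 * g) {Y : Set (ComplexTorus Φ)}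
    (hY : HasPureDim 𝓘(ℂ, E) Y k) {D : Fin k → Set (ComplexTorus Φ)} (hD : ∀ j, HasPureDim 𝓘(ℂ, E) (D j) q) :
    ∃ N : ℕ, torusIntegral Φ e ((orientationSign Φ e : ℂ) ^ (k + 1) •
        ((analyticCycleClass Φ e hk hY).wedge
            (wedgeFamily k fun j ↦ analyticCycleClass Φ e hq (hD j))).domDomCongr
          (finCongr (by omega : 2 * p + 2 * k = 2 * g))) = N ∧
      IsOpen {τ : Fin k → ComplexTorus Φ | (Y ∩ ⋂ j, (fun x ↦ x + τ j) ⁻¹' D j).Finite ∧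
        (orientationSign Φ e : ℂ) ^ k •
            ((analyticCycleClass Φ e hk hY).wedge
                (wedgeFamily k fun j ↦ analyticCycleClass Φ e hq (hD j))).domDomCongr
              (finCongr (by omega : 2 * p + 2 * k = 2 * g)) =
          setCycleClass Φ e (by omega : 2 * 0 + 2 * g = 2 * g) (Y ∩ ⋂ j, (fun x ↦ x + τ j) ⁻¹' D j)} ∧
      Dense {τ : Fin k → ComplexTorus Φ | (Y ∩ ⋂ j, (fun x ↦ x + τ j) ⁻¹' D j).Finite ∧
        (orientationSign Φ e : ℂ) ^ k •
            ((analyticCycleClass Φ e hk hY).wedge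
                (wedgeFamily k fun j ↦ analyticCycleClass Φ e hq (hD j))).domDomCongr
              (finCongr (by omega : 2 * p + 2 * k = 2 * g)) =
          setCycleClass Φ e (by omega : 2 * 0 + 2 * g = 2 * g) (Y ∩ ⋂ j, (fun x ↦ x + τ j) ⁻¹' D j)} ∧
      ∀ᵐ τ ∂(volume : Measure (Fin k → ComplexTorus Φ)),
        (Y ∩ ⋂ j, (fun x ↦ x + τ j) ⁻¹' D j).Finite ∧
          (orientationSign Φ e : ℂ) ^ k •
              ((analyticCycleClass Φ e hk hY).wedge
                  (wedgeFamily k fun j ↦ analyticCycleClass Φ e hq (hD j))).domDomCongr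
                (finCongr (by omega : 2 * p + 2 * k = 2 * g)) =
            setCycleClass Φ e (by omega : 2 * 0 + 2 * g = 2 * g) (Y ∩ ⋂ j, (fun x ↦ x + τ j) ⁻¹' D j) := by
  obtain ⟨N, hN, hopen, hdense, hae⟩ := exists_nat_isOpen_dense_ae_finite_and_ncard_eq Φ e hq k hk hY hD
  have hset := setOf_finite_and_smul_wedge_wedgeFamily_eq_setCycleClass_eq Φ e hq k hk hY hD hN
  refine ⟨N, hN, ?_, ?_, ?_⟩
  · rw [hset]; exact hopen
  · rw [hset]; exact hdense
  · filter_upwards [hae] with τ hτ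
    have hmem : τ ∈ {τ : Fin k → ComplexTorus Φ | (Y ∩ ⋂ j, (fun x ↦ x + τ j) ⁻¹' D j).Finite ∧
        (Y ∩ ⋂ j, (fun x ↦ x + τ j) ⁻¹' D j).ncard = N} := hτ
    rw [← hset] at hmem
    exact hmem

end ComplexTorus

end Literature.Geometry.Kaehler

end
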